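import Summits.QuantumFields.YangMills.Theses.SmallCircleAnchor

/-!
# Certificate c3 — the cruxes of `SmallCircleAnchor` feed the assembly ONLY through the inline torus gap
(crux stmt-QuantumFields-11142 `AdiabaticContinuity`, line `registered`, continuation lead c3, 2026-08-17)

`TorusGapInline` := for every compact simple `G` and every `r`, the undeformed Wilson theory on the symmetric
torus `ℤ_L × (ℤ/L)³` clusters exponentially in a spatial direction, uniformly in `L`, for all large `β` —
VERBATIM the hypothesis of the proved support `EndpointTransfer` (stmt-QuantumFields-11145), universally
quantified over `G, r`; equivalently the `s = 0` slice of Leg B of the crux with the anchor hypothesis DROPPED.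

* `closes_without_cruxes : TorusGapInline → EndpointTransfer → ContinuumLegGivenGap → YangMills` — the route's
  deciding theorem goes through with NEITHER `AnchorGap` NOR `AdiabaticContinuity`: the two cruxes enter
  `Theses.SmallCircleAnchor.closes` only to manufacture `TorusGapInline` (lead c1 showed the crux is used only through
  Leg B at `s = 0`; this is the same observation with the anchor removed as well).
* `adiabaticCore_of_torusGap : TorusGapInline → AnchorToTorus` — the load-bearing core of the crux (c1,
  `Lines/BirthPromoteCore.lean`, restated here verbatim) follows from the anchor-FREE torus gap by ignoring the anchor
  hypothesis: formally the anchor gives the core nothing it could not be given for free, i.e. the hypothesis of the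
  crux is inert (c1/c2: no identity transports it to `T' ≠ T` or to the symmetric torus; c3 LEAD-REPORT: physically
  inert as well — every leg re-contains the weak-coupling four-dimensional gap).

So, as a DECOMPOSITION of the shared target `UniformLatticeGap`, the pair (AnchorGap, AdiabaticContinuity) has the
shape (milestone with no typed outflow, target-strength statement with an idle hypothesis). `lean check`: rc 0,
sorries 0, standard axioms.
-/

namespace Summit.QuantumFields.YangMills.Cruxes.AdiabaticContinuity.Birth.CertC3

open scoped BigOperators Topology Manifold Classical MeasureTheory ProbabilityTheory Matrix InnerProductSpace ComplexConjugate ContinuousMap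
open Filter Set Function TopologicalSpace MeasureTheory
open Summit.QuantumFields.YangMills.Theses.SmallCircleAnchor

/-- **Inline torus gap**: the hypothesis of `EndpointTransfer`, for every compact simple `G` and every `r`
(undeformed symmetric Wilson torus clusters uniformly in `L` for all `β ≥ β₁`). -/
def TorusGapInline : Prop :=
  ∀ (G : Type) [Group G] [TopologicalSpace G] [IsTopologicalGroup G] [CompactSpace G], Literature.MathematicalPhysics.QuantumFieldTheory.IsCompactSimpleLieGroup G → letI : MeasurableSpace G := borel G; haveI : BorelSpace G := ⟨rfl⟩; ∀ r : Literature.MathematicalPhysics.QuantumFieldTheory.LatticeRep G, ∃ β₁ : ℝ, ∀ β : ℝ, β₁ ≤ β → ∃ m : ℝ, 0 < m ∧ ∀ w : ℕ, ∃ C : ℝ, ∀ (L : ℕ) [NeZero L], let St := ZMod L × (Fin 3 → ZMod L); let Cfg := St × Option (Fin 3) → G; let ν : MeasureTheory.Measure Cfg := MeasureTheory.Measure.pi fun _ => Literature.MathematicalPhysics.QuantumFieldTheory.haarProbability G; let sh : St → Option (Fin 3) → St := fun x μ => Option.elim μ (x.1 + 1, x.2) fun i => (x.1, x.2 + Pi.single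 i 1); let pl : Cfg → St → Option (Fin 3) → Option (Fin 3) → G := fun U x μ κ => U (x, μ) * U (sh x μ, κ) * (U (sh x κ, μ))⁻¹ * (U (x, κ))⁻¹; let act : Cfg → ℝ := fun U => β * ∑ x : St, ∑ i : Fin 3, (r.ρ (pl U x none (some i))).trace.re + β * ∑ x : St, ∑ q : {q : Fin 3 × Fin 3 // q.1 < q.2}, (r.ρ (pl U x (some q.1.1) (some q.1.2))).trace.re; let wgt : Cfg → ℝ := fun U => Real.exp (act U); let Ex : (Cfg → ℝ) → ℝ := fun F => (∫ U, F U * wgt U ∂ν) / (∫ U, wgt U ∂ν); let σ : ℕ → Cfg → Cfg := fun n U p => U ((p.1.1, p.1.2 + Pi.single 0 (n : ZMod L)), p.2); ∀ (c : Fin 3 → ZMod L), let Loc := fun F : Cfg → ℝ => Measurable F ∧ (∀ U, |F U| ≤ 1) ∧ ∀ U U', (∀ p, (∀ i : Fin 3, (p.1.2 i - c i).val ≤ w) → U p = U' p) → F U = F U'; ∀ F₁ F₂ : Cfg → ℝ, Loc F₁ → Loc F₂ → ∀ n : ℕ, 2 * n < L → |Ex (fun U => F₁ U * F₂ (σ n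 U)) - Ex F₁ * Ex (fun U => F₂ (σ n U))| ≤ C * Real.exp (-(m * n))

/-- **The route closes without either crux, given the inline torus gap.** (Proof: the last two lines of
`Theses.SmallCircleAnchor.closes`.) -/
theorem closes_without_cruxes : TorusGapInline → EndpointTransfer → ContinuumLegGivenGap → YangMills := by
  intro hT hE hC G i1 i2 i3 i4 hG
  refine hC G hG fun r => ?_
  exact hE G hG r (hT G hG r)

/-- **The load-bearing core of the crux** (lead c1, `Lines/BirthPromoteCore.lean`, verbatim): the crux's prefix and
anchor hypothesis, conclusion = Leg B at `s = 0` only. -/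
def AnchorToTorus : Prop :=
  ∀ (G : Type) [Group G] [TopologicalSpace G] [IsTopologicalGroup G] [CompactSpace G], Literature.MathematicalPhysics.QuantumFieldTheory.IsCompactSimpleLieGroup G → letI : MeasurableSpace G := borel G; haveI : BorelSpace G := ⟨rfl⟩; ∀ (r : Literature.MathematicalPhysics.QuantumFieldTheory.LatticeRep G) (V : G → ℝ), (Continuous V ∧ (∀ a g : G, V (a * g * a⁻¹) = V g) ∧ ∃ g₀ : G, (∀ g : G, V g₀ ≤ V g) ∧ (∀ g : G, V g = V g₀ → ∃ a : G, g = a * g₀ * a⁻¹) ∧ (∀ a b : G, a * g₀ = g₀ * a → b * g₀ = g₀ * b → a * b = b * a)) → ∀ (T : ℕ) [NeZero T], let Cl := fun (τ : ℕ → ℕ) (s β m : ℝ) => ∀ w : ℕ, ∃ C : ℝ, ∀ (L : ℕ) [NeZero L] [NeZero (τ L)], let St := ZMod (τ L) × (Fin 3 → ZMod L); let Cfg := St × Option (Fin 3) → G; let ν : MeasureTheory.Measure Cfg := MeasureTheory.Measure.pi fun _ => Literature.MathematicalPhysics.QuantumFieldTheory.haarProbability G; let sh : St → Option (Fin 3)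 → St := fun x μ => Option.elim μ (x.1 + 1, x.2) fun i => (x.1, x.2 + Pi.single i 1); let pl : Cfg → St → Option (Fin 3) → Option (Fin 3) → G := fun U x μ κ => U (x, μ) * U (sh x μ, κ) * (U (sh x κ, μ))⁻¹ * (U (x, κ))⁻¹; let act : Cfg → ℝ := fun U => β * ∑ x : St, ∑ i : Fin 3, (r.ρ (pl U x none (some i))).trace.re + β * ∑ x : St, ∑ q : {q : Fin 3 × Fin 3 // q.1 < q.2}, (r.ρ (pl U x (some q.1.1) (some q.1.2))).trace.re; let P : Cfg → (Fin 3 → ZMod L) → G := fun U x => (List.ofFn fun t : Fin (τ L) => U ((((t : ℕ) : ZMod (τ L)), x), none)).prod; let wgt : Cfg → ℝ := fun U => Real.exp (act U - s * ∑ x : Fin 3 → ZMod L, V (P U x)); let Ex : (Cfg → ℝ) → ℝ := fun F => (∫ U, F U * wgt U ∂ν) / (∫ U, wgt U ∂ν); let σ : ℕ → Cfg → Cfg := fun n U p => U ((p.1.1, p.1.2 + Pi.single 0 (n : ZMod L)), p.2); ∀ (c : Fin 3 → ZMod L), let Loc := fun F : Cfg → ℝ => Measurable F ∧ (∀ U,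 |F U| ≤ 1) ∧ ∀ U U', (∀ p, (∀ i : Fin 3, (p.1.2 i - c i).val ≤ w) → U p = U' p) → F U = F U'; ∀ F₁ F₂ : Cfg → ℝ, Loc F₁ → Loc F₂ → ∀ n : ℕ, 2 * n < L → |Ex (fun U => F₁ U * F₂ (σ n U)) - Ex F₁ * Ex (fun U => F₂ (σ n U))| ≤ C * Real.exp (-(m * n)); ∃ ε₁ : ℝ, ∀ E : ℝ → ℝ, (∀ β : ℝ, ε₁ ≤ E β) → ∀ β₀ : ℝ, (∀ β : ℝ, β₀ ≤ β → ∃ m : ℝ, 0 < m ∧ ∀ w : ℕ, ∃ C : ℝ, ∀ (L : ℕ) [NeZero L], let St := ZMod T × (Fin 3 → ZMod L); let Cfg := St × Option (Fin 3) → G; let ν : MeasureTheory.Measure Cfg := MeasureTheory.Measure.pi fun _ => Literature.MathematicalPhysics.QuantumFieldTheory.haarProbability G; let sh : St → Option (Fin 3) → St := fun x μ => Option.elim μ (x.1 + 1, x.2) fun i => (x.1, x.2 + Pi.single i 1); let pl : Cfg → St → Option (Fin 3) → Option (Fin 3) → G := fun U x μ κ => U (x, μ) * U (sh x μ, κ)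 * (U (sh x κ, μ))⁻¹ * (U (x, κ))⁻¹; let act : Cfg → ℝ := fun U => β * ∑ x : St, ∑ i : Fin 3, (r.ρ (pl U x none (some i))).trace.re + β * ∑ x : St, ∑ q : {q : Fin 3 × Fin 3 // q.1 < q.2}, (r.ρ (pl U x (some q.1.1) (some q.1.2))).trace.re; let P : Cfg → (Fin 3 → ZMod L) → G := fun U x => (List.ofFn fun t : Fin T => U ((((t : ℕ) : ZMod T), x), none)).prod; let wgt : Cfg → ℝ := fun U => Real.exp (act U - E β * ∑ x : Fin 3 → ZMod L, V (P U x)); let Ex : (Cfg → ℝ) → ℝ := fun F => (∫ U, F U * wgt U ∂ν) / (∫ U, wgt U ∂ν); let σ : ℕ → Cfg → Cfg := fun n U p => U ((p.1.1, p.1.2 + Pi.single 0 (n : ZMod L)), p.2); ∀ (c : Fin 3 → ZMod L), let Loc := fun F : Cfg → ℝ => Measurable F ∧ (∀ U, |F U| ≤ 1) ∧ ∀ U U', (∀ p, (∀ i : Fin 3, (p.1.2 i - c i).val ≤ w) → U p = U' p) → F U = F U'; ∀ F₁ F₂ : Cfg → ℝ, Loc F₁ → Loc F₂ → ∀ n :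 ℕ, 2 * n < L → |Ex (fun U => F₁ U * F₂ (σ n U)) - Ex F₁ * Ex (fun U => F₂ (σ n U))| ≤ C * Real.exp (-(m * n))) → ∃ β₁ : ℝ, ∀ β : ℝ, β₁ ≤ β → ∃ m : ℝ, 0 < m ∧ Cl (fun L => L) 0 β m

/-- **The anchor hypothesis is formally idle for the core**: the anchor-free torus gap gives `AnchorToTorus` by
discarding the hypothesis (and `AnchorToTorus` is all the assembly uses of the crux, c1 `closes_of_core`). -/
theorem adiabaticCore_of_torusGap (hT : TorusGapInline) : AnchorToTorus := by
  intro G _ _ _ _ hG r V _ T _ Cl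
  refine ⟨0, fun E _ β₀ _ => ?_⟩
  obtain ⟨β₁, hβ₁⟩ := hT G hG r
  refine ⟨β₁, fun β hβ => ?_⟩
  obtain ⟨m, hm, hcl⟩ := hβ₁ β hβ
  refine ⟨m, hm, fun w => ?_⟩
  obtain ⟨C, hC⟩ := hcl w
  refine ⟨C, fun L _ _ => ?_⟩
  simpa only [zero_mul, sub_zero] using @hC L _

end Summit.QuantumFields.YangMills.Cruxes.AdiabaticContinuity.Birth.CertC3
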